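import Mathlib.Analysis.SpecialFunctions.Exp
import Mathlib.Algebra.Order.BigOperators.Ring.Finset

/-!
# `Balaban1983to89.B9Eq349ConjugatedQTowerLetterLinear` — T. Bałaban, *Propagators for lattice gauge theories in a background field*, Commun. Math. Phys.
# **99** (1985) 389–434 [Balaban1985BackgroundPropagators] (3.15)∕(3.16) p. 393, (3.42) p. 397, (3.49) p. 399, Thm 3.11 p. 416: **THE TOWER CONJUGATION
# LETTER IS LINEAR IN THE CUT-OFF READINGS UNDER ONE WINDOW** — for non-negative reals `x_j, y_j` (`j ∈ s`, any finite index set) and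
# `P := Π_{j∈s}(1 + x_j)`: `Π_{j∈s}(1 + x_j + y_j) − P ≤ P·(exp(Σ_{j∈s} y_j) − 1) ≤ P·(Σ_j y_j)·exp(Σ_j y_j)`, hence `≤ e·P·Σ_{j∈s} y_j` on the window
# `Σ_{j∈s} y_j ≤ 1`; read at `x_j = c·θ_j`, `y_j = c·e_j` (`c = √(L^d)`, `θ_j` the flat-composite size letters, `e_j = 2(‖κ‖ℓ′_j)·w_j` the per-level
# conjugation increments) this is the located remark L-g148-3 of the NE9 crux-ideation seat t4-ne9-idea-1 (gen 148, journal 2026-08-24T23:40:44Z) on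
# the END constant `(Π_{j<n}(1 + √(L^d)(θ_j + e_j)) − Π_{j<n}(1 + √(L^d)θ_j))·ρ^n` of the OWNER lineage t4-ne9-p1's tower letter
# `B9Eq349ConjugatedQTowerLetters.sqrt_sum_norm_sq_Qtower_conj_sub_le`: the difference of the two products is LINEAR in `‖κ‖·Σ_j ℓ′_j w_j` under the one
# extra window `√(L^d)·Σ_j e_j ≤ 1` — the shape the β-window files `B9Eq326ClosingBetaWindow` ∕ `B9Eq3126QG1QClosingBetaWindow` consume (constraints
# LINEAR in the conjugation letters), now also at the tower

statement-level skeleton of published theorems with citation tags; proofs where landed; nothing here is a claim about the Yang–Mills mass gap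

CITATION HEADER (lean-in-tree rule).  Audit cell `pub-balaban`, sub-cell `t4`, BINDER row NE9 (road ΔA-CT at the tower); filed by NE9 formalisation-swarm
leaf prover 03 (`b2b-balaban-t4-ne9-formalise-leaf-03`, gen 76); the inequality and its use are t4-ne9-idea-1 g148's located remark L-g148-3 — CREDIT.
Mathlib only.  Sources READ first-hand: [Balaban1985BackgroundPropagators] p. 393 (3.15)∕(3.16) (the composite averaging `Q_k = Q∘…∘Q`), p. 397 (3.42),
p. 399 (3.49) (print's kernels decay with SOME rate `δ₀` — NOT asserted), p. 416 Thm 3.11.  Pure real arithmetic (`1 + y ≤ e^y`, `e^s − 1 ≤ s·e^s`,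
products of non-negative factors are monotone); nothing of print's is asserted; no number of record.

WHAT IS PROVED (sorry-free; proof lane — no `def`; [folklore] real arithmetic).
* §1 `exp_sub_one_le_exp_one_mul` (`0 ≤ s ≤ 1 ⟹ e^s − 1 ≤ e·s`, via the tree's `AreaLaw.exp_sub_one_le_mul_exp` shape inline), `prod_one_add_le_exp_sum`
  (`Π(1 + y_j) ≤ exp(Σ y_j)`), `prod_one_add_add_le_prod_mul_prod` (`Π(1 + x_j + y_j) ≤ Π(1 + x_j)·Π(1 + y_j)`), `sub_nonneg_prod_one_add_add`,
  **`prod_one_add_add_sub_prod_le_exp`** (`Π(1 + x_j + y_j) − P ≤ P·(exp(Σy) − 1)`), `prod_one_add_add_sub_prod_le_mul_exp` (`≤ P·(Σy)·exp(Σy)`),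
  **`prod_one_add_add_sub_prod_le_linear`** (`Σy ≤ 1 ⟹ ≤ e·P·Σy`).
* §2 the reading in the tower letter's shape: **`prod_one_add_mul_add_sub_prod_le_linear`** (`c ≥ 0`, `c·Σe ≤ 1 ⟹ Π(1 + c(θ_j + e_j)) − Π(1 + cθ_j) ≤
  e·Π(1 + cθ_j)·(c·Σ_j e_j)`) and **`prod_one_add_mul_add_sub_prod_le_linear_of_le`** (`e_j ≤ r·a_j`, `c·r·Σa ≤ 1 ⟹ … ≤ e·Π(1 + cθ_j)·c·r·Σ_j a_j` —
  LINEAR in the conjugation radius `r = ‖κ‖`).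
HONEST SCOPE.  Abstract real inequalities; `θ_j, e_j, ℓ′_j, w_j, c` are LETTERS; no number; the window `Σ y_j ≤ 1` is this file's price; NOT NE9 (cell
pub-balaban: NE9 NOT PRINTED ∕ NOT PROVED; «NE9 ⇐ the named binders»; row WALLED ON A MODEL (O-NE9-1; #5 UNRULED); spine PROVED 0∕9; rung (B)+1 on a finite
T⁴ — NOT infinite volume, NOT mass gap, NOT BetaPertH, NOT Clay; HONEST DEPENDENCY: continuum YM on T⁴ ⇐ BetaPertH ∧ nine spine estimates (0/9 proved);
BetaPertH ⇐ (D1) ∧ (D4) ∧ CAP+tail).  NEW file; nothing modified.  Net new unproved facts: 0.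
-/

open scoped BigOperators

namespace Literature.MathematicalPhysics.QuantumFieldTheory.Balaban1983to89.B9Eq349ConjugatedQTowerLetterLinear

variable {ι : Type*}

/-! ## §1 The product difference under one window -/

/-- `0 ≤ s ≤ 1 ⟹ e^s − 1 ≤ e·s` (via `e^s − 1 ≤ s·e^s`, the tree's `AreaLaw.exp_sub_one_le_mul_exp` — re-derived inline from `1 − s ≤ e^{−s}` to keep
this file Mathlib-only). [folklore] [cite: Balaban1985BackgroundPropagators, (3.49) p.399] -/
theorem exp_sub_one_le_exp_one_mul {s : ℝ} (hs : 0 ≤ s) (hs1 : s ≤ 1) : Real.exp s - 1 ≤ Real.exp 1 * s := by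
  have h : -s + 1 ≤ Real.exp (-s) := Real.add_one_le_exp (-s)
  have hpos : 0 < Real.exp s := Real.exp_pos s
  have h0 : Real.exp s * (-s + 1) ≤ Real.exp s * Real.exp (-s) := mul_le_mul_of_nonneg_left h hpos.le
  rw [← Real.exp_add, add_neg_cancel, Real.exp_zero] at h0
  have h2 : s * Real.exp s ≤ s * Real.exp 1 := mul_le_mul_of_nonneg_left (Real.exp_le_exp.mpr hs1) hs
  nlinarith

/-- `Π_{j∈s}(1 + y_j) ≤ exp(Σ_{j∈s} y_j)` for `y_j ≥ 0`. [folklore] [cite: Balaban1985BackgroundPropagators, (3.15) p.393, (3.49) p.399] -/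
theorem prod_one_add_le_exp_sum (s : Finset ι) {y : ι → ℝ} (hy : ∀ j ∈ s, 0 ≤ y j) :
    ∏ j ∈ s, (1 + y j) ≤ Real.exp (∑ j ∈ s, y j) := by
  rw [Real.exp_sum]
  exact Finset.prod_le_prod (fun j hj => by linarith [hy j hj]) fun j _ => by linarith [Real.add_one_le_exp (y j)]

/-- `Π_{j∈s}(1 + x_j + y_j) ≤ Π_{j∈s}(1 + x_j)·Π_{j∈s}(1 + y_j)` for `x_j, y_j ≥ 0` (`1 + x + y ≤ (1 + x)(1 + y)`). [folklore]
[cite: Balaban1985BackgroundPropagators, (3.15) p.393, (3.49) p.399] -/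
theorem prod_one_add_add_le_prod_mul_prod (s : Finset ι) {x y : ι → ℝ} (hx : ∀ j ∈ s, 0 ≤ x j) (hy : ∀ j ∈ s, 0 ≤ y j) :
    ∏ j ∈ s, (1 + x j + y j) ≤ (∏ j ∈ s, (1 + x j)) * ∏ j ∈ s, (1 + y j) := by
  rw [← Finset.prod_mul_distrib]
  exact Finset.prod_le_prod (fun j hj => by linarith [hx j hj, hy j hj]) fun j hj => by nlinarith [hx j hj, hy j hj]

/-- `0 ≤ Π_{j∈s}(1 + x_j + y_j) − Π_{j∈s}(1 + x_j)` for `x_j, y_j ≥ 0`. [folklore] [cite: Balaban1985BackgroundPropagators, (3.49) p.399] -/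
theorem sub_nonneg_prod_one_add_add (s : Finset ι) {x y : ι → ℝ} (hx : ∀ j ∈ s, 0 ≤ x j) (hy : ∀ j ∈ s, 0 ≤ y j) :
    0 ≤ ∏ j ∈ s, (1 + x j + y j) - ∏ j ∈ s, (1 + x j) :=
  sub_nonneg.mpr (Finset.prod_le_prod (fun j hj => by linarith [hx j hj]) fun j hj => by linarith [hy j hj])

/-- **THE PRODUCT DIFFERENCE IS EXPONENTIALLY SMALL IN `Σ y`**: `Π(1 + x_j + y_j) − P ≤ P·(exp(Σ_j y_j) − 1)`, `P = Π(1 + x_j)`. [folklore]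
(t4-ne9-idea-1 g148, L-g148-3) [cite: Balaban1985BackgroundPropagators, (3.15) p.393, (3.42) p.397, (3.49) p.399, Thm 3.11 p.416] -/
theorem prod_one_add_add_sub_prod_le_exp (s : Finset ι) {x y : ι → ℝ} (hx : ∀ j ∈ s, 0 ≤ x j) (hy : ∀ j ∈ s, 0 ≤ y j) :
    ∏ j ∈ s, (1 + x j + y j) - ∏ j ∈ s, (1 + x j) ≤ (∏ j ∈ s, (1 + x j)) * (Real.exp (∑ j ∈ s, y j) - 1) := by
  have hP : 0 ≤ ∏ j ∈ s, (1 + x j) := Finset.prod_nonneg fun j hj => by linarith [hx j hj]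
  have h1 := prod_one_add_add_le_prod_mul_prod s hx hy
  have h2 := mul_le_mul_of_nonneg_left (prod_one_add_le_exp_sum s hy) hP
  linarith

/-- `Π(1 + x_j + y_j) − P ≤ P·(Σ_j y_j)·exp(Σ_j y_j)` (no window). [folklore] (t4-ne9-idea-1 g148, L-g148-3) [cite: Balaban1985BackgroundPropagators, (3.49) p.399] -/
theorem prod_one_add_add_sub_prod_le_mul_exp (s : Finset ι) {x y : ι → ℝ} (hx : ∀ j ∈ s, 0 ≤ x j) (hy : ∀ j ∈ s, 0 ≤ y j) :
    ∏ j ∈ s, (1 + x j + y j) - ∏ j ∈ s, (1 + x j) ≤ (∏ j ∈ s, (1 + x j)) * ((∑ j ∈ s, y j) * Real.exp (∑ j ∈ s, y j)) := by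
  have hP : 0 ≤ ∏ j ∈ s, (1 + x j) := Finset.prod_nonneg fun j hj => by linarith [hx j hj]
  -- `e^t − 1 ≤ t·e^t` (the tree's `AreaLaw.exp_sub_one_le_mul_exp`, re-derived inline)
  have hexp : ∀ t : ℝ, Real.exp t - 1 ≤ t * Real.exp t := fun t => by
    have h : -t + 1 ≤ Real.exp (-t) := Real.add_one_le_exp (-t)
    have h0 : Real.exp t * (-t + 1) ≤ Real.exp t * Real.exp (-t) := mul_le_mul_of_nonneg_left h (Real.exp_pos t).le
    rw [← Real.exp_add, add_neg_cancel, Real.exp_zero] at h0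
    nlinarith
  exact (prod_one_add_add_sub_prod_le_exp s hx hy).trans (mul_le_mul_of_nonneg_left (hexp _) hP)

/-- **LINEAR UNDER ONE WINDOW**: `Σ_j y_j ≤ 1 ⟹ Π(1 + x_j + y_j) − P ≤ e·P·Σ_j y_j`. [folklore] (t4-ne9-idea-1 g148, L-g148-3)
[cite: Balaban1985BackgroundPropagators, (3.15) p.393, (3.42) p.397, (3.49) p.399, Thm 3.11 p.416] -/
theorem prod_one_add_add_sub_prod_le_linear (s : Finset ι) {x y : ι → ℝ} (hx : ∀ j ∈ s, 0 ≤ x j) (hy : ∀ j ∈ s, 0 ≤ y j)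
    (hwin : ∑ j ∈ s, y j ≤ 1) :
    ∏ j ∈ s, (1 + x j + y j) - ∏ j ∈ s, (1 + x j) ≤ Real.exp 1 * (∏ j ∈ s, (1 + x j)) * ∑ j ∈ s, y j := by
  have hP : 0 ≤ ∏ j ∈ s, (1 + x j) := Finset.prod_nonneg fun j hj => by linarith [hx j hj]
  have hS : 0 ≤ ∑ j ∈ s, y j := Finset.sum_nonneg hy
  have h := (prod_one_add_add_sub_prod_le_exp s hx hy).trans (mul_le_mul_of_nonneg_left (exp_sub_one_le_exp_one_mul hS hwin) hP)
  linarith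

/-! ## §2 The reading in the tower letter's shape `1 + c·(θ_j + e_j)` against `1 + c·θ_j` -/

/-- **THE TOWER LETTER, LINEAR**: `c ≥ 0`, `θ_j, e_j ≥ 0`, window `c·Σ_j e_j ≤ 1` ⟹
`Π_{j∈s}(1 + c(θ_j + e_j)) − Π_{j∈s}(1 + cθ_j) ≤ e·Π_{j∈s}(1 + cθ_j)·(c·Σ_{j∈s} e_j)`. [folklore] (t4-ne9-idea-1 g148, L-g148-3: `c = √(L^d)`,
`θ_j = √(2d)·102(d+1)²Lε_j`, `e_j = 2‖κ‖ℓ′_j·√(2(2d(102(d+1)²Lε_j)² + L^{−d}))`)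
[cite: Balaban1985BackgroundPropagators, (3.15) p.393, (3.42) p.397, (3.49) p.399, Thm 3.11 p.416] -/
theorem prod_one_add_mul_add_sub_prod_le_linear (s : Finset ι) {c : ℝ} (hc : 0 ≤ c) {θ e : ι → ℝ} (hθ : ∀ j ∈ s, 0 ≤ θ j)
    (he : ∀ j ∈ s, 0 ≤ e j) (hwin : c * ∑ j ∈ s, e j ≤ 1) :
    ∏ j ∈ s, (1 + c * (θ j + e j)) - ∏ j ∈ s, (1 + c * θ j) ≤
      Real.exp 1 * (∏ j ∈ s, (1 + c * θ j)) * (c * ∑ j ∈ s, e j) := by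
  have hx : ∀ j ∈ s, 0 ≤ c * θ j := fun j hj => mul_nonneg hc (hθ j hj)
  have hy : ∀ j ∈ s, 0 ≤ c * e j := fun j hj => mul_nonneg hc (he j hj)
  have hwin' : ∑ j ∈ s, c * e j ≤ 1 := by rwa [← Finset.mul_sum]
  have h := prod_one_add_add_sub_prod_le_linear s hx hy hwin'
  have e1 : ∏ j ∈ s, (1 + c * (θ j + e j)) = ∏ j ∈ s, (1 + c * θ j + c * e j) :=
    Finset.prod_congr rfl fun j _ => by ring
  rw [e1, Finset.mul_sum]
  exact h

/-- **… AND LINEAR IN THE CONJUGATION RADIUS**: if moreover `e_j ≤ r·a_j` (`r = ‖κ‖`; no sign needed on `r`, `a_j`) and `c·r·Σ_j a_j ≤ 1`, then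
`Π(1 + c(θ_j + e_j)) − Π(1 + cθ_j) ≤ e·Π(1 + cθ_j)·(c·r·Σ_{j∈s} a_j)`. [folklore] (t4-ne9-idea-1 g148, L-g148-3: `a_j = 2ℓ′_j·√(2(1 + 2dL^dK_max²))` on
the diagonal) [cite: Balaban1985BackgroundPropagators, (3.15) p.393, (3.49) p.399, Thm 3.11 p.416] -/
theorem prod_one_add_mul_add_sub_prod_le_linear_of_le (s : Finset ι) {c r : ℝ} (hc : 0 ≤ c) {θ e a : ι → ℝ}
    (hθ : ∀ j ∈ s, 0 ≤ θ j) (he : ∀ j ∈ s, 0 ≤ e j) (hea : ∀ j ∈ s, e j ≤ r * a j) (hwin : c * r * ∑ j ∈ s, a j ≤ 1) :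
    ∏ j ∈ s, (1 + c * (θ j + e j)) - ∏ j ∈ s, (1 + c * θ j) ≤
      Real.exp 1 * (∏ j ∈ s, (1 + c * θ j)) * (c * r * ∑ j ∈ s, a j) := by
  have hsum : ∑ j ∈ s, e j ≤ r * ∑ j ∈ s, a j := by
    rw [Finset.mul_sum]; exact Finset.sum_le_sum hea
  have hce : c * ∑ j ∈ s, e j ≤ c * r * ∑ j ∈ s, a j := by
    have := mul_le_mul_of_nonneg_left hsum hc; linarith
  have hP : 0 ≤ ∏ j ∈ s, (1 + c * θ j) := Finset.prod_nonneg fun j hj => by nlinarith [hθ j hj]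
  have h := prod_one_add_mul_add_sub_prod_le_linear s hc hθ he (hce.trans hwin)
  have hP' : 0 ≤ Real.exp 1 * ∏ j ∈ s, (1 + c * θ j) := mul_nonneg (Real.exp_pos 1).le hP
  exact h.trans (mul_le_mul_of_nonneg_left hce hP')

end Literature.MathematicalPhysics.QuantumFieldTheory.Balaban1983to89.B9Eq349ConjugatedQTowerLetterLinear
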